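import Summits.HodgeConjecture.HodgeConjecture.Theorems.UeP4OfEnginesPiece
import Summits.HodgeConjecture.HodgeConjecture.Theorems.UeP4N3corePiece
import HarnessLib

/-!
# U-e P4 on a smooth clopen piece from (F) alone: the local holomorphic period map of the Siegel universal family

Sub-problem `HodgeConjecture` (cell HC_CM, (U)-lane node U-e P4, G-AN1 «P4 local on the base / P4 on a smooth clopen piece»;
P4 lead B-p03 (g14)).  PIECE EDITION of ★ `UeP4OfF.ue_P4_of_F`: the lead's socket `UHead.Ue_P4_piece` (text verbatim) — the local
holomorphic period map of the universal family restricted to a smooth quasi-projective clopen piece `ι : S′ ⟶ M ⊗ ℂ`, around a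
complex point `t₀` of `S′` classifying an admissible triple — from the single printed fact (F) `lan2013_siegelFineModuliScheme`
([Lan2013PELCompactifications] §1.4.1): `UeP4OfEnginesPiece.ue_P4_piece_of_engines` composed with the PROVED piece engine
(N3-core) `UnivFamilyN3corePiece.ue_N3core_piece_holds`.  [LangeBirkenhake1992] Ch. 8 §8.1, [VoisinHodgeI2002] §10.2.1
Thm. 10.3, [MumfordFogartyKirwan1994] App. Ch. 7 §A.  Main result: `ue_P4_piece_of_F`.  HC_CM is proved only modulo the 7 printed
citations until rung 0 closes; this helper changes no count.

## References
* [LangeBirkenhake1992] H. Lange, Ch. Birkenhake, *Complex Abelian Varieties*, Springer 1992, Ch. 8 §8.1–8.2 (Prop. 8.1.1).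
* [VoisinHodgeI2002] C. Voisin, *Hodge Theory and Complex Algebraic Geometry I*, CUP 2002, §10.2.1 Thm. 10.3.
* [MumfordFogartyKirwan1994] D. Mumford, J. Fogarty, F. Kirwan, *Geometric Invariant Theory*, 3rd ed., Appendix to Ch. 7 §A (p. 235).
* [Lan2013PELCompactifications] K.-W. Lan, *Arithmetic compactifications of PEL-type Shimura varieties*, §1.4.1.
-/

set_option autoImplicit false
set_option linter.dupNamespace false

noncomputable section

open CategoryTheory CategoryTheory.Limits AlgebraicGeometry Matrix Topology
open Literature.AlgebraicGeometry
open Literature.AlgebraicGeometry.Motives (SchemeOver ComplexPoints AlgPoints specOver AbelianVariety CartierDivisor fiberOver)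
open Literature.AlgebraicGeometry.AbelianSchemes (PolarizedAbelianSchemeWithLevel AbelianSchemeOver)
open Literature.AlgebraicGeometry.ModuliOfAbelianVarieties
open Literature.AlgebraicGeometry.ModuliOfAbelianVarieties.SiegelModuli
open Literature.NumberTheory.Automorphic (siegelUpperHalfSpace)
open Literature.NumberTheory.Adeles

namespace Summit.HodgeConjecture.HodgeConjecture.Theorems

namespace UeP4OfFPiece

/-- **U-e P4 ON A SMOOTH CLOPEN PIECE FROM (F) ALONE — `ue_P4_piece_of_F (hF)`** (conclusion = the lead's socket text `UHead.Ue_P4_piece` verbatim).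
[cite: LangeBirkenhake1992, Ch. 8 §8.1–8.2 (Prop. 8.1.1)] [cite: VoisinHodgeI2002, §10.2.1 Thm. 10.3]
[cite: MumfordFogartyKirwan1994, Appendix to Ch. 7 §A (p. 235)] -/
theorem ue_P4_piece_of_F (hF : lan2013_siegelFineModuliScheme) :
    ∀ (g N : ℕ) (δ : Fin g → ℕ) (_hg : 0 < g) (hδ : IsPolarizationType δ) (_hN : 3 ≤ N)
      (𝓜 : SiegelFineModuliScheme g N δ) (r : gspFinAdelic δ)
      {S' : SchemeOver ℂ} (ι : S' ⟶ (Motives.baseChange ℚ ℂ).obj 𝓜.M) [IsOpenImmersion ι.left]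
      (_hSq : HodgeTheory.IsQuasiProjectiveOver S')
      (d : ℕ) [SmoothOfRelativeDimension d S'.hom],
      haveI : IsLocallyNoetherian (specOver ℚ ℂ).left :=
        inferInstanceAs (IsLocallyNoetherian (Spec (CommRingCat.of ℂ)))
      haveI : Smooth S'.hom := SmoothOfRelativeDimension.smooth d _
      haveI : LocallyOfFiniteType S'.hom := inferInstance
      r ∈ principalLevelSubgroup δ 1 →
      ∀ (Z₀ : Matrix (Fin g) (Fin g) ℂ) (hZ₀ : Z₀ ∈ siegelUpperHalfSpace g)
        (P₀ : PolarizedAbelianSchemeWithLevel g N δ (specOver ℚ ℂ).left), IsAdmissibleAt hδ r Z₀ hZ₀ P₀ →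
      ∀ (t₀ : ComplexPoints S'),
        AlgPoints.map (L := ℂ) ι t₀ =
          AlgPoints.baseChangeEquiv (algebraMap ℚ ℂ) 𝓜.M (𝓜.classifyingMap (specOver ℚ ℂ) P₀) →
      ∃ (W : Set (ComplexPoints S')) (π : ComplexPoints S' → Matrix (Fin g) (Fin g) ℂ),
        IsOpen W ∧ t₀ ∈ W ∧ π t₀ = Z₀ ∧ ContinuousOn π W ∧
        -- `π` is holomorphic on `W`, entrywise, read in every holomorphic algebraic chart of `S′(ℂ)`
        (∀ x ∈ W, ∀ (i j : Fin g),
          DifferentiableOn ℂ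
            ((fun y ↦ π y i j) ∘ (ComplexPoints.algebraicChart S' d x).symm)
            ((ComplexPoints.algebraicChart S' d x).target ∩ (ComplexPoints.algebraicChart S' d x).symm ⁻¹' W)) ∧
        -- `π` READS ADMISSIBILITY at `r` on `W`, at triples classified by `ι x`
        (∀ x ∈ W, ∃ hx : π x ∈ siegelUpperHalfSpace g,
          ∃ P' : PolarizedAbelianSchemeWithLevel g N δ (specOver ℚ ℂ).left,
            IsAdmissibleAt hδ r (π x) hx P' ∧
            AlgPoints.baseChangeEquiv (algebraMap ℚ ℂ) 𝓜.M (𝓜.classifyingMap (specOver ℚ ℂ) P') = AlgPoints.map (L := ℂ) ι x) :=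
  UeP4OfEnginesPiece.ue_P4_piece_of_engines hF UnivFamilyN3corePiece.ue_N3core_piece_holds

end UeP4OfFPiece

end Summit.HodgeConjecture.HodgeConjecture.Theorems

end
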